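import Literature.Dynamics.NBody.AlbouyKaloshin2012SymmetricCCsAll
import Literature.Dynamics.NBody.Moulton1910Collinear

/-!
# All reflection-symmetric central configurations of the Roberts masses `(1,1,1,1,1/4)`

Topic `Literature/Dynamics/NBody`; `pub-smale6` cell, seat 1 gen 3. `AlbouyKaloshin2012SymmetricCCsAll.lean` (with Moulton's collinear
finiteness, `Moulton1910Collinear.lean`; packaged in `AlbouyKaloshin2012SymmetricCCsFinal.lean`) reduces finiteness
of the positive normalized central configurations ([AlbouyKaloshin2012] Definition 1) of `(1,1,1,1,1/4)` with a reflection
symmetry of type `id`, `(1 2)`, `(3 4)` or `(1 2)(3 4)` to the finiteness of three slice systems. For these masses the four unit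
bodies are interchangeable, so a reflection symmetry may also be of type `(1 3)`, `(1 4)`, `(2 3)`, `(2 4)`, `(1 3)(2 4)` or
`(1 4)(2 3)`. This file removes that restriction: `roberts_reflSymmCCs_finite` — ALL reflection-symmetric positive normalized
central configurations of `(1,1,1,1,1/4)` (`reflSymmCCs`) are finite in number, given the same three hypotheses.

The new ingredient is the RELABEL-AND-ROTATE transfer `transferPerm π q = R_q ∘ q ∘ π`: relabel the bodies by a permutation `π`
preserving the masses and rotate by the rotation `R_q` (`rotU`, general rotations; `normRot`) that makes the new bodies 1, 2 lie on
a horizontal line, so that the normalization `y₁ = y₂` of Definition 1 is restored. System (1) is equivariant (`newtonForce_perm`,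
`newtonForce_rotU`), a reflection symmetry is carried to a reflection symmetry of the conjugate type (`rotU_reflLine`), and the
transfer is at most two-to-one on normalized configurations (`transferPerm_fibre`: equal images force `q' = ± q`), so finiteness
pulls back (`finite_transfer_preimage`). The six extra types are conjugate in `S₄` to `(1 2)` or `(1 2)(3 4)`.
-/

namespace Literature.Dynamics.NBody

open Finset

/-- Rotation of the plane by the angle with cosine `a` and sine `β` (meaningful when `a² + β² = 1`), as a linear map.
[folklore] -/
def rotU (a β : ℝ) : (ℝ × ℝ) →ₗ[ℝ] (ℝ × ℝ) :=
  (a • LinearMap.fst ℝ ℝ ℝ - β • LinearMap.snd ℝ ℝ ℝ).prod (β • LinearMap.fst ℝ ℝ ℝ + a • LinearMap.snd ℝ ℝ ℝ)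

/-- `rotU a β (x, y) = (a x − β y, β x + a y)`. [folklore] -/
@[simp] theorem rotU_apply (a β : ℝ) (p : ℝ × ℝ) :
    rotU a β p = (a * p.1 - β * p.2, β * p.1 + a * p.2) := rfl

/-- Rotations preserve squared distances. [folklore] -/
theorem sqDist_rotU {a β : ℝ} (hab : a ^ 2 + β ^ 2 = 1) (p q : ℝ × ℝ) :
    sqDist (rotU a β p) (rotU a β q) = sqDist p q := by
  simp only [sqDist, rotU_apply]
  linear_combination ((q.1 - p.1) ^ 2 + (q.2 - p.2) ^ 2) * hab

/-- Rotation symmetry of system (1): `f(m, R ∘ q)_k = R (f(m, q)_k)`. [folklore] -/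
theorem newtonForce_rotU {a β : ℝ} (hab : a ^ 2 + β ^ 2 = 1) {n : ℕ} (m : Fin n → ℝ) (q : Fin n → ℝ × ℝ)
    (k : Fin n) : newtonForce m (fun l => rotU a β (q l)) k = rotU a β (newtonForce m q k) := by
  rw [newtonForce_eq_sum_univ, newtonForce_eq_sum_univ, map_sum]
  refine Finset.sum_congr rfl fun l _ => ?_
  rw [sqDist_rotU hab, map_smul, map_sub]

/-- Composition of rotations (angle addition). [folklore] -/
theorem rotU_comp (a β a' β' : ℝ) (p : ℝ × ℝ) :
    rotU a' β' (rotU a β p) = rotU (a * a' - β * β') (β * a' + a * β') p := by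
  simp only [rotU_apply]
  ext <;> ring

/-- The inverse rotation. [folklore] -/
theorem rotU_inv {a β : ℝ} (hab : a ^ 2 + β ^ 2 = 1) (p : ℝ × ℝ) : rotU a (-β) (rotU a β p) = p := by
  rw [rotU_comp, rotU_apply]
  ext <;> simp <;> first
    | linear_combination p.1 * hab
    | linear_combination p.2 * hab

/-- Rotations are injective. [folklore] -/
theorem rotU_injective {a β : ℝ} (hab : a ^ 2 + β ^ 2 = 1) : Function.Injective (rotU a β) := by
  intro p q h
  have := congrArg (rotU a (-β)) h
  rwa [rotU_inv hab, rotU_inv hab] at this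

/-- Conjugating a line reflection by a rotation gives the line reflection with rotated normal. [folklore] -/
theorem rotU_reflLine {a β : ℝ} (hab : a ^ 2 + β ^ 2 = 1) (a' β' d : ℝ) (x : ℝ × ℝ) :
    rotU a β (reflLine a' β' d x) =
      reflLine (a * a' - β * β') (β * a' + a * β') d (rotU a β x) := by
  simp only [rotU_apply, reflLine]
  ext <;> simp only <;> first
    | linear_combination 2 * (a * a' - β * β') * (a' * x.1 + β' * x.2) * hab
    | linear_combination 2 * (β * a' + a * β') * (a' * x.1 + β' * x.2) * hab

/-- The rotated normal is a unit vector. [folklore] -/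
theorem rotU_unit {a β a' β' : ℝ} (hab : a ^ 2 + β ^ 2 = 1) (hab' : a' ^ 2 + β' ^ 2 = 1) :
    (a * a' - β * β') ^ 2 + (β * a' + a * β') ^ 2 = 1 := by
  linear_combination (a' ^ 2 + β' ^ 2) * hab + hab'

/-- The (cosine, sine) of the rotation taking the vector `v ≠ 0` to the positive `x`-axis. [folklore] -/
noncomputable def normRot (v : ℝ × ℝ) : ℝ × ℝ :=
  (v.1 / Real.sqrt (v.1 ^ 2 + v.2 ^ 2), -v.2 / Real.sqrt (v.1 ^ 2 + v.2 ^ 2))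

/-- `normRot v` is a unit vector for `v ≠ 0`. [folklore] -/
theorem normRot_unit {v : ℝ × ℝ} (hv : v ≠ 0) : (normRot v).1 ^ 2 + (normRot v).2 ^ 2 = 1 := by
  have hne : v.1 ≠ 0 ∨ v.2 ≠ 0 := by
    by_contra h
    have h' : v.1 = 0 ∧ v.2 = 0 := by
      constructor <;> by_contra hc <;> exact h (by tauto)
    exact hv (Prod.ext (by simpa using h'.1) (by simpa using h'.2))
  have hpos : 0 < v.1 ^ 2 + v.2 ^ 2 := by
    rcases hne with h | h <;> positivity
  have hr : Real.sqrt (v.1 ^ 2 + v.2 ^ 2) ^ 2 = v.1 ^ 2 + v.2 ^ 2 := Real.sq_sqrt hpos.le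
  simp only [normRot]
  rw [div_pow, div_pow, neg_sq, ← add_div, hr]
  exact div_self hpos.ne'

/-- The rotation `normRot v` makes `v` horizontal. [folklore] -/
theorem normRot_horizontal (v : ℝ × ℝ) : (normRot v).2 * v.1 + (normRot v).1 * v.2 = 0 := by
  simp only [normRot]
  ring

/-- The rotation attached to a configuration and a relabelling: it makes the new bodies 1, 2 horizontal. [folklore] -/
noncomputable def transferRot (π : Equiv.Perm (Fin 5)) (q : Fin 5 → ℝ × ℝ) : ℝ × ℝ :=
  normRot (q (π 1) - q (π 0))

/-- RELABEL-AND-ROTATE: `(transferPerm π q)_k = R_q (q_{π k})`. [folklore] -/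
noncomputable def transferPerm (π : Equiv.Perm (Fin 5)) (q : Fin 5 → ℝ × ℝ) : Fin 5 → ℝ × ℝ :=
  fun k => rotU (transferRot π q).1 (transferRot π q).2 (q (π k))

/-- The transfer rotation of a configuration with distinct bodies is a genuine rotation. [folklore] -/
theorem transferRot_unit {m : Fin 5 → ℝ} {q : Fin 5 → ℝ × ℝ} (hq : IsPositiveNormalizedCC m q)
    (π : Equiv.Perm (Fin 5)) : (transferRot π q).1 ^ 2 + (transferRot π q).2 ^ 2 = 1 := by
  have hne : π 1 ≠ π 0 := fun h => by
    have := π.injective h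
    exact absurd this (by decide)
  exact normRot_unit (sub_ne_zero.mpr (hq.1 _ _ hne))

/-- The transfer of a positive normalized central configuration by a mass-preserving relabelling is a positive normalized
central configuration of the same masses. [folklore] -/
theorem transferPerm_isPositiveNormalizedCC {m : Fin 5 → ℝ} {q : Fin 5 → ℝ × ℝ} (hq : IsPositiveNormalizedCC m q)
    (π : Equiv.Perm (Fin 5)) (hπ : ∀ k, m (π k) = m k) : IsPositiveNormalizedCC m (transferPerm π q) := by
  have hab := transferRot_unit hq π
  refine ⟨?_, ?_, ?_⟩
  · intro k l hkl h
    exact hq.1 (π k) (π l) (fun e => hkl (π.injective e)) (rotU_injective hab h)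
  · intro k
    have hm : m ∘ π = m := funext hπ
    have h1 := newtonForce_rotU hab m (q ∘ π) k
    have h2 : newtonForce m (q ∘ π) k = newtonForce m q (π k) := by
      have := newtonForce_perm m q π k
      rwa [hm] at this
    show rotU _ _ (q (π k)) = newtonForce m (fun l => rotU _ _ (q (π l))) k
    have e : (fun l => rotU (transferRot π q).1 (transferRot π q).2 (q (π l))) =
        fun l => rotU (transferRot π q).1 (transferRot π q).2 ((q ∘ π) l) := rfl
    rw [e, h1, h2, ← hq.2.1 (π k)]
  · intro h0 h1
    have e1 : (⟨1, h1⟩ : Fin 5) = 1 := rfl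
    have e0 : (⟨0, h0⟩ : Fin 5) = 0 := rfl
    rw [e1, e0]
    show (rotU _ _ (q (π 1))).2 = (rotU _ _ (q (π 0))).2
    have := normRot_horizontal (q (π 1) - q (π 0))
    simp only [transferRot, rotU_apply, Prod.fst_sub, Prod.snd_sub] at this ⊢
    linarith

/-- A reflection symmetry `ρ(q_{π k}) = q_{π l}` is carried to the conjugate reflection symmetry
`ρ'((transferPerm π q)_k) = (transferPerm π q)_l`. [folklore] -/
theorem transferPerm_reflLine {q : Fin 5 → ℝ × ℝ} (π : Equiv.Perm (Fin 5))
    (hab : (transferRot π q).1 ^ 2 + (transferRot π q).2 ^ 2 = 1) {a' β' d : ℝ} {k l : Fin 5}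
    (h : reflLine a' β' d (q (π k)) = q (π l)) :
    reflLine ((transferRot π q).1 * a' - (transferRot π q).2 * β') ((transferRot π q).2 * a' + (transferRot π q).1 * β') d
      (transferPerm π q k) = transferPerm π q l := by
  simp only [transferPerm]
  rw [← rotU_reflLine hab, h]

/-- The transfer is at most two-to-one on normalized configurations: equal images force `q' = q` or `q' = −q`.
[folklore] -/
theorem transferPerm_fibre {m : Fin 5 → ℝ} {q q' : Fin 5 → ℝ × ℝ} (hq : IsPositiveNormalizedCC m q)
    (hq' : IsPositiveNormalizedCC m q') (π : Equiv.Perm (Fin 5)) (h : transferPerm π q = transferPerm π q') :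
    q' = q ∨ q' = -q := by
  have hab := transferRot_unit hq π
  have hab' := transferRot_unit hq' π
  set a := (transferRot π q).1 with ha
  set β := (transferRot π q).2 with hβ
  set a' := (transferRot π q').1 with ha'
  set β' := (transferRot π q').2 with hβ'
  have hpt : ∀ j, rotU a β (q j) = rotU a' β' (q' j) := by
    intro j
    have := congrFun h (π.symm j)
    simpa [transferPerm, Equiv.apply_symm_apply] using this
  have hQ : ∀ j, q' j = rotU (a * a' + β * β') (β * a' - a * β') (q j) := by
    intro j
    have := congrArg (rotU a' (-β')) (hpt j)
    rw [rotU_inv hab', rotU_comp] at this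
    have e1 : a * a' - β * -β' = a * a' + β * β' := by ring
    have e2 : β * a' + a * -β' = β * a' - a * β' := by ring
    rw [e1, e2] at this
    exact this.symm
  have hAB : (a * a' + β * β') ^ 2 + (β * a' - a * β') ^ 2 = 1 := by
    linear_combination (a' ^ 2 + β' ^ 2) * hab + hab'
  have hy : (q 1).2 = (q 0).2 := by
    have := hq.2.2 (by norm_num) (by norm_num); simpa using this
  have hy' : (q' 1).2 = (q' 0).2 := by
    have := hq'.2.2 (by norm_num) (by norm_num); simpa using this
  have hne : q 0 ≠ q 1 := hq.1 0 1 (by decide)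
  have e0 := congrArg Prod.snd (hQ 0)
  have e1 := congrArg Prod.snd (hQ 1)
  simp only [rotU_apply] at e0 e1
  have hB : (β * a' - a * β') * ((q 1).1 - (q 0).1) = 0 := by
    linear_combination -e1 + e0 + hy' - (a * a' + β * β') * hy
  have hΔ : (q 1).1 - (q 0).1 ≠ 0 := by
    intro h0
    exact hne (Prod.ext (by linarith) hy.symm)
  have hB0 : β * a' - a * β' = 0 := (mul_eq_zero.mp hB).resolve_right hΔ
  have hA : (a * a' + β * β') ^ 2 = 1 := by
    have : (β * a' - a * β') ^ 2 = 0 := by rw [hB0]; ring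
    linarith [hAB]
  have hA' : (a * a' + β * β' - 1) * (a * a' + β * β' + 1) = 0 := by
    linear_combination hA
  rcases mul_eq_zero.mp hA' with h1 | h1
  · left
    have hA1 : a * a' + β * β' = 1 := by linarith
    funext j
    rw [hQ j, hA1, hB0, rotU_apply]
    simp
  · right
    have hA1 : a * a' + β * β' = -1 := by linarith
    funext j
    rw [Pi.neg_apply, hQ j, hA1, hB0, rotU_apply]
    ext <;> simp

/-- Pull-back of finiteness through the transfer: the positive normalized CCs whose transfer lies in a finite set are
finite in number. [folklore] -/
theorem finite_transfer_preimage {m : Fin 5 → ℝ} (π : Equiv.Perm (Fin 5)) {T : Set (Fin 5 → ℝ × ℝ)}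
    (hT : T.Finite) : {q | IsPositiveNormalizedCC m q ∧ transferPerm π q ∈ T}.Finite := by
  have hsub : {q | IsPositiveNormalizedCC m q ∧ transferPerm π q ∈ T} ⊆
      ⋃ p ∈ T, {q | IsPositiveNormalizedCC m q ∧ transferPerm π q = p} := by
    intro q hq
    simp only [Set.mem_iUnion, Set.mem_setOf_eq]
    exact ⟨transferPerm π q, hq.2, hq.1, rfl⟩
  refine (hT.biUnion fun p _ => ?_).subset hsub
  by_cases hex : ∃ q₀, IsPositiveNormalizedCC m q₀ ∧ transferPerm π q₀ = p
  · obtain ⟨q₀, hq₀, hp₀⟩ := hex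
    refine (((Set.finite_singleton (-q₀)).insert q₀)).subset ?_
    rintro q ⟨hq, hqp⟩
    rcases transferPerm_fibre hq₀ hq π (hp₀.trans hqp.symm) with h | h
    · exact Or.inl h
    · exact Or.inr h
  · have : {q | IsPositiveNormalizedCC m q ∧ transferPerm π q = p} = ∅ := by
      ext q
      simp only [Set.mem_setOf_eq, Set.mem_empty_iff_false, iff_false, not_and]
      exact fun hq hqp => hex ⟨q, hq, hqp⟩
    rw [this]
    exact Set.finite_empty

/-- The Roberts masses take the value `1/4` at body 5 and `1` elsewhere. [folklore] -/
theorem e32Masses_roberts_apply (j : Fin 5) :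
    e32Masses 1 (1 / 4) j = if j = 4 then (1 / 4 : ℝ) else 1 := by
  fin_cases j <;> simp [e32Masses]

/-- A relabelling fixing body 5 preserves the Roberts masses. [folklore] -/
theorem e32Masses_roberts_perm (π : Equiv.Perm (Fin 5)) (hπ : π 4 = 4) (k : Fin 5) :
    e32Masses 1 (1 / 4) (π k) = e32Masses 1 (1 / 4) k := by
  rw [e32Masses_roberts_apply, e32Masses_roberts_apply]
  by_cases hk : k = 4
  · subst hk; simp [hπ]
  · have : π k ≠ 4 := fun h => hk (π.injective (h.trans hπ.symm))
    simp [hk, this]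

/-- Transfer leaf, type (1 2): if `ρ` exchanges `q_{π 0}, q_{π 1}` and fixes `q_{π 2}, q_{π 3}, q_{π 4}` (`π` fixing body 5), the
transferred configuration is a type-(1 2) symmetric CC of the Roberts masses. [folklore] -/
theorem transferPerm_mem_reflSymm12CCs {q : Fin 5 → ℝ × ℝ} (hcc : IsPositiveNormalizedCC (e32Masses 1 (1 / 4)) q)
    {a β d : ℝ} (hab : a ^ 2 + β ^ 2 = 1) (π : Equiv.Perm (Fin 5)) (hπ : π 4 = 4)
    (h0 : reflLine a β d (q (π 0)) = q (π 1)) (h2 : reflLine a β d (q (π 2)) = q (π 2))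
    (h3 : reflLine a β d (q (π 3)) = q (π 3)) (h4 : reflLine a β d (q (π 4)) = q (π 4)) :
    transferPerm π q ∈ reflSymm12CCs 1 (1 / 4) := by
  have hr := transferRot_unit hcc π
  exact ⟨transferPerm_isPositiveNormalizedCC hcc π (e32Masses_roberts_perm π hπ), _, _, d, rotU_unit hr hab,
    transferPerm_reflLine π hr h0, transferPerm_reflLine π hr h2, transferPerm_reflLine π hr h3,
    transferPerm_reflLine π hr h4⟩

/-- Transfer leaf, type (1 2)(3 4). [folklore] -/
theorem transferPerm_mem_reflSymm1234CCs {q : Fin 5 → ℝ × ℝ} (hcc : IsPositiveNormalizedCC (e32Masses 1 (1 / 4)) q)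
    {a β d : ℝ} (hab : a ^ 2 + β ^ 2 = 1) (π : Equiv.Perm (Fin 5)) (hπ : π 4 = 4)
    (h0 : reflLine a β d (q (π 0)) = q (π 1)) (h2 : reflLine a β d (q (π 2)) = q (π 3))
    (h4 : reflLine a β d (q (π 4)) = q (π 4)) :
    transferPerm π q ∈ reflSymm1234CCs 1 (1 / 4) := by
  have hr := transferRot_unit hcc π
  exact ⟨transferPerm_isPositiveNormalizedCC hcc π (e32Masses_roberts_perm π hπ), _, _, d, rotU_unit hr hab,
    transferPerm_reflLine π hr h0, transferPerm_reflLine π hr h2, transferPerm_reflLine π hr h4⟩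

/-- The transfer sets used for the Roberts masses: positive normalized CCs whose transfer by `π` is of type (1 2) or
(1 2)(3 4). [folklore] -/
def transferSet (π : Equiv.Perm (Fin 5)) : Set (Fin 5 → ℝ × ℝ) :=
  {q | IsPositiveNormalizedCC (e32Masses 1 (1 / 4)) q ∧
    transferPerm π q ∈ reflSymm12CCs 1 (1 / 4) ∪ reflSymm1234CCs 1 (1 / 4)}

/-- **Classification for the Roberts masses.** Every reflection-symmetric positive normalized CC of `(1,1,1,1,1/4)` is of
type `id`, (1 2), (3 4), (1 2)(3 4), or is carried by one of the four relabel-and-rotate transfers `π ∈ {(1 3), (1 4),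
(2 3), (2 4)}` (0-indexed swaps `0↔2, 0↔3, 1↔2, 1↔3`) to one of type (1 2) or (1 2)(3 4). [folklore] -/
theorem roberts_reflSymmCCs_subset :
    reflSymmCCs (e32Masses 1 (1 / 4)) ⊆
      (reflSymmIdCCs 1 (1 / 4) ∪ reflSymm12CCs 1 (1 / 4) ∪ reflSymm34CCs 1 (1 / 4) ∪ reflSymm1234CCs 1 (1 / 4)) ∪
      (transferSet (Equiv.swap 0 2) ∪ transferSet (Equiv.swap 0 3) ∪ transferSet (Equiv.swap 1 2) ∪
        transferSet (Equiv.swap 1 3)) := by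
  rintro q ⟨hcc, a, β, d, hab, h⟩
  have four : ∀ l : Fin 5, e32Masses 1 (1 / 4) l = 1 → l = 0 ∨ l = 1 ∨ l = 2 ∨ l = 3 := by
    intro l; fin_cases l <;> norm_num [e32Masses] <;> decide
  have mc : ∀ l : Fin 5, e32Masses 1 (1 / 4) l = 1 / 4 → l = 4 := by
    intro l; fin_cases l <;> (norm_num [e32Masses]; try decide)
  have invol := reflLine_reflLine hab d
  have inj : ∀ x y : ℝ × ℝ, reflLine a β d x = reflLine a β d y → x = y :=
    fun x y hxy => by rw [← invol x, hxy, invol y]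
  have inv' : ∀ {x y : ℝ × ℝ}, reflLine a β d x = y → reflLine a β d y = x :=
    fun {x y} hxy => by rw [← hxy, invol x]
  have ne : ∀ i j : Fin 5, i ≠ j → q i ≠ q j := hcc.1
  -- `clash hi hj hij`: ρ(q i) = ρ(q j) with i ≠ j is absurd
  have clash : ∀ {i j : Fin 5} {X : ℝ × ℝ}, reflLine a β d (q i) = X → reflLine a β d (q j) = X → i ≠ j → False :=
    fun {i j X} hi hj hij => ne i j hij (inj _ _ (hi.trans hj.symm))
  obtain ⟨l0, hm0, h0⟩ := h 0
  obtain ⟨l1, hm1, h1⟩ := h 1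
  obtain ⟨l2, hm2, h2⟩ := h 2
  obtain ⟨l3, hm3, h3⟩ := h 3
  obtain ⟨l4, hm4, h4⟩ := h 4
  have e0 : e32Masses 1 (1 / 4) 0 = 1 := rfl
  have e1 : e32Masses 1 (1 / 4) 1 = 1 := rfl
  have e2 : e32Masses 1 (1 / 4) 2 = 1 := rfl
  have e3 : e32Masses 1 (1 / 4) 3 = 1 := rfl
  have e4 : e32Masses 1 (1 / 4) 4 = 1 / 4 := rfl
  rw [e0] at hm0; rw [e1] at hm1; rw [e2] at hm2; rw [e3] at hm3; rw [e4] at hm4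
  obtain rfl := mc l4 hm4
  have s02_0 : (Equiv.swap (0 : Fin 5) 2) 0 = 2 := by decide
  have s02_1 : (Equiv.swap (0 : Fin 5) 2) 1 = 1 := by decide
  have s02_2 : (Equiv.swap (0 : Fin 5) 2) 2 = 0 := by decide
  have s02_3 : (Equiv.swap (0 : Fin 5) 2) 3 = 3 := by decide
  have s02_4 : (Equiv.swap (0 : Fin 5) 2) 4 = 4 := by decide
  have s03_0 : (Equiv.swap (0 : Fin 5) 3) 0 = 3 := by decide
  have s03_1 : (Equiv.swap (0 : Fin 5) 3) 1 = 1 := by decide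
  have s03_2 : (Equiv.swap (0 : Fin 5) 3) 2 = 2 := by decide
  have s03_3 : (Equiv.swap (0 : Fin 5) 3) 3 = 0 := by decide
  have s03_4 : (Equiv.swap (0 : Fin 5) 3) 4 = 4 := by decide
  have s12_0 : (Equiv.swap (1 : Fin 5) 2) 0 = 0 := by decide
  have s12_1 : (Equiv.swap (1 : Fin 5) 2) 1 = 2 := by decide
  have s12_2 : (Equiv.swap (1 : Fin 5) 2) 2 = 1 := by decide
  have s12_3 : (Equiv.swap (1 : Fin 5) 2) 3 = 3 := by decide
  have s12_4 : (Equiv.swap (1 : Fin 5) 2) 4 = 4 := by decide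
  have s13_0 : (Equiv.swap (1 : Fin 5) 3) 0 = 0 := by decide
  have s13_1 : (Equiv.swap (1 : Fin 5) 3) 1 = 3 := by decide
  have s13_2 : (Equiv.swap (1 : Fin 5) 3) 2 = 2 := by decide
  have s13_3 : (Equiv.swap (1 : Fin 5) 3) 3 = 1 := by decide
  have s13_4 : (Equiv.swap (1 : Fin 5) 3) 4 = 4 := by decide
  rcases four l0 hm0 with rfl | rfl | rfl | rfl
  · -- body 0 fixed
    rcases four l1 hm1 with rfl | rfl | rfl | rfl
    · exact (clash h1 h0 (by decide)).elim
    · -- bodies 0, 1 fixed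
      rcases four l2 hm2 with rfl | rfl | rfl | rfl
      · exact (clash h2 h0 (by decide)).elim
      · exact (clash h2 h1 (by decide)).elim
      · rcases four l3 hm3 with rfl | rfl | rfl | rfl
        · exact (clash h3 h0 (by decide)).elim
        · exact (clash h3 h1 (by decide)).elim
        · exact (clash h3 h2 (by decide)).elim
        · left; left; left; left
          exact ⟨hcc, a, β, d, hab, fun k => by fin_cases k <;> assumption⟩
      · -- type (3 4)
        left; left; right
        exact ⟨hcc, a, β, d, hab, h0, h1, h2, h4⟩
    · -- σ = (1 2): transfer by swap 0 2
      have h2' : reflLine a β d (q 2) = q 1 := inv' h1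
      rcases four l3 hm3 with rfl | rfl | rfl | rfl
      · exact (clash h3 h0 (by decide)).elim
      · exact (clash h3 h2' (by decide)).elim
      · exact (clash h3 h1 (by decide)).elim
      · right; left; left; left
        refine ⟨hcc, Or.inl (transferPerm_mem_reflSymm12CCs (d := d) hcc hab _ s02_4 ?_ ?_ ?_ ?_)⟩
        · simp only [s02_0, s02_1]; exact h2'
        · simp only [s02_2]; exact h0
        · simp only [s02_3]; exact h3
        · simp only [s02_4]; exact h4
    · -- σ = (1 3): transfer by swap 0 3
      have h3' : reflLine a β d (q 3) = q 1 := inv' h1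
      rcases four l2 hm2 with rfl | rfl | rfl | rfl
      · exact (clash h2 h0 (by decide)).elim
      · exact (clash h2 h3' (by decide)).elim
      · right; left; left; right
        refine ⟨hcc, Or.inl (transferPerm_mem_reflSymm12CCs (d := d) hcc hab _ s03_4 ?_ ?_ ?_ ?_)⟩
        · simp only [s03_0, s03_1]; exact h3'
        · simp only [s03_2]; exact h2
        · simp only [s03_3]; exact h0
        · simp only [s03_4]; exact h4
      · exact (clash h2 h1 (by decide)).elim
  · -- σ exchanges 0 and 1
    have h1' : reflLine a β d (q 1) = q 0 := inv' h0
    rcases four l2 hm2 with rfl | rfl | rfl | rfl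
    · exact (clash h2 h1' (by decide)).elim
    · exact (clash h2 h0 (by decide)).elim
    · rcases four l3 hm3 with rfl | rfl | rfl | rfl
      · exact (clash h3 h1' (by decide)).elim
      · exact (clash h3 h0 (by decide)).elim
      · exact (clash h3 h2 (by decide)).elim
      · -- type (1 2)
        left; left; left; right
        exact ⟨hcc, a, β, d, hab, h0, h2, h3, h4⟩
    · -- type (1 2)(3 4)
      left; right
      exact ⟨hcc, a, β, d, hab, h0, h2, h4⟩
  · -- σ exchanges 0 and 2: transfer by swap 1 2
    have h2' : reflLine a β d (q 2) = q 0 := inv' h0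
    rcases four l1 hm1 with rfl | rfl | rfl | rfl
    · exact (clash h1 h2' (by decide)).elim
    · rcases four l3 hm3 with rfl | rfl | rfl | rfl
      · exact (clash h3 h2' (by decide)).elim
      · exact (clash h3 h1 (by decide)).elim
      · exact (clash h3 h0 (by decide)).elim
      · right; left; right
        refine ⟨hcc, Or.inl (transferPerm_mem_reflSymm12CCs (d := d) hcc hab _ s12_4 ?_ ?_ ?_ ?_)⟩
        · simp only [s12_0, s12_1]; exact h0
        · simp only [s12_2]; exact h1
        · simp only [s12_3]; exact h3
        · simp only [s12_4]; exact h4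
    · exact (clash h1 h0 (by decide)).elim
    · -- σ = (0 2)(1 3)
      right; left; right
      refine ⟨hcc, Or.inr (transferPerm_mem_reflSymm1234CCs (d := d) hcc hab _ s12_4 ?_ ?_ ?_)⟩
      · simp only [s12_0, s12_1]; exact h0
      · simp only [s12_2, s12_3]; exact h1
      · simp only [s12_4]; exact h4
  · -- σ exchanges 0 and 3: transfer by swap 1 3
    have h3' : reflLine a β d (q 3) = q 0 := inv' h0
    rcases four l2 hm2 with rfl | rfl | rfl | rfl
    · exact (clash h2 h3' (by decide)).elim
    · -- σ = (0 3)(1 2)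
      right; right
      refine ⟨hcc, Or.inr (transferPerm_mem_reflSymm1234CCs (d := d) hcc hab _ s13_4 ?_ ?_ ?_)⟩
      · simp only [s13_0, s13_1]; exact h0
      · simp only [s13_2, s13_3]; exact h2
      · simp only [s13_4]; exact h4
    · rcases four l1 hm1 with rfl | rfl | rfl | rfl
      · exact (clash h1 h3' (by decide)).elim
      · right; right
        refine ⟨hcc, Or.inl (transferPerm_mem_reflSymm12CCs (d := d) hcc hab _ s13_4 ?_ ?_ ?_ ?_)⟩
        · simp only [s13_0, s13_1]; exact h0
        · simp only [s13_2]; exact h2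
        · simp only [s13_3]; exact h1
        · simp only [s13_4]; exact h4
      · exact (clash h1 h2 (by decide)).elim
      · exact (clash h1 h0 (by decide)).elim
    · exact (clash h2 h0 (by decide)).elim

/-- **All reflection-symmetric central configurations of the Roberts masses.** If the real solution sets of the three slice
systems `T12(1,1/4)` on the sign branches `++++`, `+++−` and `T1234(1,1/4)` on `++` are finite, then the positive normalized
central configurations of `(1,1,1,1,1/4)` ([AlbouyKaloshin2012] Definition 1) admitting ANY reflection symmetry are finite
in number. (Moulton's theorem and the relabel-and-rotate transfer are proved; only the three zero-dimensionality statements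
are hypotheses.) [cite: AlbouyKaloshin2012, Remark 8 p. 583] -/
theorem roberts_reflSymmCCs_finite
    (hA : (t12BranchSet 1 1 1 1 1 (1 / 4)).Finite) (hB : (t12BranchSet 1 1 1 (-1) 1 (1 / 4)).Finite)
    (hC : (t1234BranchSet 1 1 1 (1 / 4)).Finite) :
    (reflSymmCCs (e32Masses 1 (1 / 4))).Finite := by
  have hm : ∀ k, 0 < e32Masses 1 (1 / 4) k := by
    intro k
    fin_cases k <;> simp [e32Masses]
  have hU := roberts_fourTypes_finite (collinear_positiveNormalizedCCs_finite hm) hA hB hC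
  have hT : (reflSymm12CCs 1 (1 / 4) ∪ reflSymm1234CCs 1 (1 / 4)).Finite :=
    (roberts_reflSymm12CCs_finite_of_two hA hB).union (roberts_reflSymm1234CCs_finite_of_one hC)
  have hF : ∀ π : Equiv.Perm (Fin 5), (transferSet π).Finite := fun π => finite_transfer_preimage π hT
  have hF4 : (transferSet (Equiv.swap 0 2) ∪ transferSet (Equiv.swap 0 3) ∪ transferSet (Equiv.swap 1 2) ∪
      transferSet (Equiv.swap 1 3)).Finite := (((hF _).union (hF _)).union (hF _)).union (hF _)
  exact (hU.union hF4).subset roberts_reflSymmCCs_subset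

end Literature.Dynamics.NBody
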